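import Summits.KontsevichZagierPeriods.KontsevichZagierPeriods.Theorems.LinRedNormalFormArrangementNormalFormStubIntegrateOutLowOrderCells

/-!
# `stub_integrateOutLow` (crux `ArrangementNormalForm`, line `janus-bands`)

`G₂lo b → closure (J b)`: a rebased Janus band representation with base `(x', y)` whose rational
part depends on `y` only through `(y − ℓ₁(x'))^{n₁} / (y − ℓ₂(x'))^{n₂}` with `n₂ ≤ 1`, whose
fibre letters are `y`-free and whose affine fibre bounds are `y`-free or `y` itself, is congruent
modulo the KZ moves to a `ℤ`-combination of Janus band representations with base `x'`:

1. cut the base cell at `y = ℓ₁(x')` (rule 1a, the hyperplane is null):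
   `IntegrateOutLow.of_sub_sum_branch`;
2. on each branch unfold `(y − ℓ₁)^{n₁} = ± n₁-fold integral of 1` into `n₁` letter-free fibre
   coordinates between `ℓ₁(x')` and `y` by reverse Newton–Leibniz moves (rule 3,
   `integrateOutLow_unfold`, file `…StubIntegrateOutLowHelpers`): `IntegrateOutLow.exists_unfolded`
   (file `…StubIntegrateOutLowOrderCells`);
3. transport along `b + 1 + k + n₁ = b + (k + 1 + n₁)` and re-read `y` as the first fibre: the
   result is an order-constrained Janus representation over the base `x'` (rows involving `y`
   are solved for `y`, the letter of `y` is `ℓ₂` if `n₂ = 1`), hence a sum of Janus band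
   representations by total-order refinement (`integrateOutLow_orderCells`):
   `IntegrateOutLow.exists_J_of_unfolded`.

No integrand is ever split, so every piece is absolutely convergent.
-/

noncomputable section

open MeasureTheory Set MvPolynomial
open Literature.NumberTheory.Transcendental Literature.ModelTheory.ExponentialFields

namespace Summit.KontsevichZagierPeriods.ArrangementNormalForm.JanusBands

namespace IntegrateOutLow

variable {b k m m' n₁ n₂ : ℕ} (s : KZ.IntegralRep (b + 1 + k)) (ℓ₁ : (Fin b → ℚ) × ℚ)
  (A B : Bool → MvPolynomial (Fin (b + 1 + k)) ℚ)
  (hAB : ∀ β z, (aeval z (A β) = if β then ∑ i, (ℓ₁.1 i : ℝ) * z (Fin.castAdd k (Fin.castSucc i)) +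
      (ℓ₁.2 : ℝ) else z (Fin.castAdd k (Fin.last b))) ∧
    (aeval z (B β) = if β then z (Fin.castAdd k (Fin.last b)) else
      ∑ i, (ℓ₁.1 i : ℝ) * z (Fin.castAdd k (Fin.castSucc i)) + (ℓ₁.2 : ℝ)))

include hAB in
/-- **Cutting at `y = ℓ₁(x')`** (rule 1a): the two branch pieces `{ℓ₁ < y}`, `{y < ℓ₁}` cover the
domain up to the null hyperplane `{y = ℓ₁}`. -/
theorem of_sub_sum_branch : KZ.of s - ∑ β, KZ.of (s.restrict
    (s.domain ∩ {z | aeval z (A β) < aeval z (B β)})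
    (s.isSemialgebraic_domain.inter (isSemialgebraic_setOf_eval_lt _ _)) inter_subset_left) ∈
    KZ.relations := by
  refine KZ.of_sub_sum_of_mem_relations Finset.univ s _
    (fun β _ => by simp only [KZ.IntegralRep.domain_restrict,
      sdiff_eq_empty.mpr inter_subset_left, measure_empty]) (fun β _ _ _ => rfl) ?_ ?_
  · have hne : ∀ i : Fin b, (Fin.castAdd k (Fin.castSucc i) : Fin (b + 1 + k)) ≠
        Fin.castAdd k (Fin.last b) := fun i h =>
      (Fin.castSucc_lt_last i).ne (Fin.castAdd_injective _ _ h)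
    refine measure_mono_null (fun z hz => ?_) (volume_setOf_aeval_eq (A false) (B false)
      (fun j => if j = Fin.castAdd k (Fin.last b) then (ℓ₁.2 : ℝ) + 1 else 0) ?_)
    · simp only [mem_sdiff, mem_iUnion, Finset.mem_univ, exists_true_left, not_exists,
        KZ.IntegralRep.domain_restrict, mem_inter_iff, mem_setOf_eq, not_and, not_lt] at hz
      show aeval z (A false) = aeval z (B false)
      have h1 := hz.2 true hz.1
      have h2 := hz.2 false hz.1
      rw [(hAB true z).1, (hAB true z).2] at h1
      rw [(hAB false z).1, (hAB false z).2] at h2 ⊢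
      simp only [if_true, Bool.false_eq_true, if_false] at h1 h2 ⊢
      exact le_antisymm h1 h2
    · rw [(hAB false _).1, (hAB false _).2]
      simp [hne]
  · intro β _ β' _ hne
    simp only [KZ.IntegralRep.domain_restrict]
    rw [show s.domain ∩ {z | aeval z (A β) < aeval z (B β)} ∩
        (s.domain ∩ {z | aeval z (A β') < aeval z (B β')}) = ∅ from ?_, measure_empty]
    refine eq_empty_of_forall_notMem fun z ⟨⟨_, h1⟩, ⟨_, h2⟩⟩ => ?_
    simp only [mem_setOf_eq] at h1 h2
    rw [(hAB _ z).1, (hAB _ z).2] at h1 h2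
    cases β <;> cases β' <;> simp at hne h1 h2 <;> linarith

variable (L : Fin m → (Fin b → ℚ) × ℚ) (e : Fin m → ℕ) (p : MvPolynomial (Fin b) ℚ)
  (ℓ₂ : (Fin b → ℚ) × ℚ) (a : Fin k → Option ((Fin (b + 1) → ℚ) × ℚ))

variable (M : Fin m' → (Fin (b + 1) → ℚ) × ℚ) (lo hi : Fin k → Fin k ⊕ ((Fin (b + 1) → ℚ) × ℚ))

include hAB in
/-- **Re-reading `y` as the first fibre.** The unfolded branch piece, transported to dimension
`b + (k + 1 + n₁)`, is an order-constrained Janus representation over the base `x'` (rows of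
the base cell involving `y` are solved for `y`; `y`-free bounds and letters restrict to the base;
the bound "`y` itself" becomes the fibre `y`; the unfolded coordinates range in `(A_β, B_β)`),
hence a sum of Janus band representations (`integrateOutLow_orderCells`). -/
theorem exists_J_of_unfolded (hn₂ : n₂ ≤ 1) (ha : ∀ i c, a i = some c → c.1 (Fin.last b) = 0)
    (hlohi : ∀ i c, (lo i = Sum.inr c ∨ hi i = Sum.inr c) →
      (c.1 (Fin.last b) = 0 ∨ c = (Pi.single (Fin.last b) 1, 0)))
    (hbd : Bornology.IsBounded s.domain)
    (hdom : s.domain = {z | (∀ j, 0 < ∑ i, ((M j).1 i : ℝ) * z (Fin.castAdd k i) + ((M j).2 : ℝ)) ∧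
      ∀ i, Sum.elim (fun j => z (Fin.natAdd (b + 1) j))
      (fun c => ∑ i', (c.1 i' : ℝ) * z (Fin.castAdd k i') + (c.2 : ℝ)) (lo i) <
      z (Fin.natAdd (b + 1) i) ∧ z (Fin.natAdd (b + 1) i) <
      Sum.elim (fun j => z (Fin.natAdd (b + 1) j))
      (fun c => ∑ i', (c.1 i' : ℝ) * z (Fin.castAdd k i') + (c.2 : ℝ)) (hi i)})
    (β : Bool) (U : KZ.IntegralRep (b + 1 + k + n₁))
    (hUd : U.domain = {z | (fun i => z (Fin.castAdd n₁ i)) ∈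
          s.domain ∩ {z | aeval z (A β) < aeval z (B β)} ∧
        ∀ i : Fin n₁, aeval (fun i => z (Fin.castAdd n₁ i)) (A β) < z (Fin.natAdd (b + 1 + k) i) ∧
          z (Fin.natAdd (b + 1 + k) i) < aeval (fun i => z (Fin.castAdd n₁ i)) (B β)})
    (hUi : U.integrand = (fun z => (if β then (1 : ℝ) else -1) ^ n₁ *
        (MvPolynomial.aeval (fun i => z (Fin.castAdd n₁ (Fin.castAdd k (Fin.castSucc i)))) p /
        (∏ j, (∑ i, ((L j).1 i : ℝ) * z (Fin.castAdd n₁ (Fin.castAdd k (Fin.castSucc i))) +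
          ((L j).2 : ℝ)) ^ e j) /
        (z (Fin.castAdd n₁ (Fin.castAdd k (Fin.last b))) - (∑ i, (ℓ₂.1 i : ℝ) *
          z (Fin.castAdd n₁ (Fin.castAdd k (Fin.castSucc i))) + (ℓ₂.2 : ℝ))) ^ n₂ *
        ∏ i, (a i).elim 1 (fun c => 1 / (z (Fin.castAdd n₁ (Fin.natAdd (b + 1) i)) -
          (∑ i', (c.1 i' : ℝ) * z (Fin.castAdd n₁ (Fin.castAdd k i')) + (c.2 : ℝ))))))) :
    ∃ c ∈ AddSubgroup.closure {w : KZ.FormalRep | ∃ (k m m' : ℕ) (s : KZ.IntegralRep (b + k))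
      (M : Fin m' → (Fin b → ℚ) × ℚ) (L : Fin m → (Fin b → ℚ) × ℚ) (e : Fin m → ℕ)
      (p : MvPolynomial (Fin b) ℚ) (a : Fin k → Option ((Fin b → ℚ) × ℚ))
      (lo hi : Fin k → Fin k ⊕ ((Fin b → ℚ) × ℚ)), Bornology.IsBounded s.domain ∧
      s.domain = {z | (∀ j, 0 < ∑ i, ((M j).1 i : ℝ) * z (Fin.castAdd k i) + ((M j).2 : ℝ)) ∧
      ∀ i, Sum.elim (fun j => z (Fin.natAdd b j))
      (fun c => ∑ i', (c.1 i' : ℝ) * z (Fin.castAdd k i') + (c.2 : ℝ)) (lo i) <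
      z (Fin.natAdd b i) ∧ z (Fin.natAdd b i) < Sum.elim (fun j => z (Fin.natAdd b j))
      (fun c => ∑ i', (c.1 i' : ℝ) * z (Fin.castAdd k i') + (c.2 : ℝ)) (hi i)} ∧
      EqOn s.integrand (fun z => MvPolynomial.aeval (fun i => z (Fin.castAdd k i)) p /
      (∏ j, (∑ i, ((L j).1 i : ℝ) * z (Fin.castAdd k i) + ((L j).2 : ℝ)) ^ e j) *
      ∏ i, (a i).elim 1 (fun c => 1 / (z (Fin.natAdd b i) -
      (∑ i', (c.1 i' : ℝ) * z (Fin.castAdd k i') + (c.2 : ℝ))))) s.domain ∧ w = KZ.of s},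
      KZ.of U - c ∈ KZ.relations := by
  obtain ⟨R₀, hR₀⟩ := hbd.exists_norm_le
  have hc : b + 1 + k + n₁ = b + (k + 1 + n₁) := by omega
  have cx : ∀ i : Fin b, Fin.cast hc (Fin.castAdd n₁ (Fin.castAdd k (Fin.castSucc i))) =
      Fin.castAdd (k + 1 + n₁) i := fun i => Fin.ext (by simp)
  have cy : Fin.cast hc (Fin.castAdd n₁ (Fin.castAdd k (Fin.last b))) =
      Fin.natAdd b (Fin.castAdd n₁ (0 : Fin (k + 1))) := Fin.ext (by simp)
  have ct : ∀ i : Fin k, Fin.cast hc (Fin.castAdd n₁ (Fin.natAdd (b + 1) i)) =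
      Fin.natAdd b (Fin.castAdd n₁ i.succ) := fun i => Fin.ext (by simp; omega)
  have cu : ∀ i : Fin n₁, Fin.cast hc (Fin.natAdd (b + 1 + k) i) =
      Fin.natAdd b (Fin.natAdd (k + 1) i) := fun i => Fin.ext (by simp; omega)
  -- values of players
  set PV : Fin (k + 1 + n₁) ⊕ ((Fin b → ℚ) × ℚ) → (Fin (b + (k + 1 + n₁)) → ℝ) → ℝ := fun u w =>
    Sum.elim (fun j => w (Fin.natAdd b j))
      (fun c => ∑ i', (c.1 i' : ℝ) * w (Fin.castAdd (k + 1 + n₁) i') + (c.2 : ℝ)) u with hPV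
  set y0 : Fin (k + 1 + n₁) := Fin.castAdd n₁ (0 : Fin (k + 1)) with hy0
  -- the players and the constraints
  set PL : Fin (k + 1 + n₁) ⊕ ((Fin b → ℚ) × ℚ) := if β then Sum.inr ℓ₁ else Sum.inl y0 with hPL
  set PH : Fin (k + 1 + n₁) ⊕ ((Fin b → ℚ) × ℚ) := if β then Sum.inl y0 else Sum.inr ℓ₁ with hPH
  set bnd : Fin k ⊕ ((Fin (b + 1) → ℚ) × ℚ) → Fin (k + 1 + n₁) ⊕ ((Fin b → ℚ) × ℚ) :=
    Sum.elim (fun j => Sum.inl (Fin.castAdd n₁ j.succ))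
      (fun c => if c = (Pi.single (Fin.last b) 1, 0) then Sum.inl y0
        else Sum.inr (fun i => c.1 (Fin.castSucc i), c.2)) with hbnd
  set rowC : Fin m' →
      (Fin (k + 1 + n₁) ⊕ ((Fin b → ℚ) × ℚ)) × (Fin (k + 1 + n₁) ⊕ ((Fin b → ℚ) × ℚ)) :=
    fun j => if 0 < (M j).1 (Fin.last b) then
        (Sum.inr (fun i => -(M j).1 (Fin.castSucc i) / (M j).1 (Fin.last b),
          -(M j).2 / (M j).1 (Fin.last b)), Sum.inl y0)
      else if (M j).1 (Fin.last b) < 0 then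
        (Sum.inl y0, Sum.inr (fun i => -(M j).1 (Fin.castSucc i) / (M j).1 (Fin.last b),
          -(M j).2 / (M j).1 (Fin.last b)))
      else (Sum.inr (0, 0), Sum.inr (fun i => (M j).1 (Fin.castSucc i), (M j).2)) with hrowC
  set R : ℕ := ⌈R₀⌉₊ + 1 with hR
  set Cs : Finset ((Fin (k + 1 + n₁) ⊕ ((Fin b → ℚ) × ℚ)) ×
      (Fin (k + 1 + n₁) ⊕ ((Fin b → ℚ) × ℚ))) :=
    Finset.univ.image rowC ∪
    Finset.univ.image (fun i => (bnd (lo i), Sum.inl (Fin.castAdd n₁ i.succ))) ∪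
    Finset.univ.image (fun i => (Sum.inl (Fin.castAdd n₁ i.succ), bnd (hi i))) ∪
    Finset.univ.image (fun i => (PL, Sum.inl (Fin.natAdd (k + 1) i))) ∪
    Finset.univ.image (fun i => (Sum.inl (Fin.natAdd (k + 1) i), PH)) ∪
    {(PL, PH), (Sum.inr (0, -(R : ℚ)), Sum.inl y0), (Sum.inl y0, Sum.inr (0, (R : ℚ)))} with hCs
  -- semantic values
  have hrow : ∀ w j, PV (rowC j).1 w < PV (rowC j).2 w ↔
      0 < ∑ i, ((M j).1 (Fin.castSucc i) : ℝ) * w (Fin.castAdd (k + 1 + n₁) i) +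
        ((M j).1 (Fin.last b) : ℝ) * w (Fin.natAdd b y0) + ((M j).2 : ℝ) := by
    intro w j
    have hq : ∀ x : Fin b → ℚ, ∀ q c : ℚ,
        ∑ i, ((-x i / q : ℚ) : ℝ) * w (Fin.castAdd (k + 1 + n₁) i) +
        ((-c / q : ℚ) : ℝ) = -(∑ i, (x i : ℝ) * w (Fin.castAdd (k + 1 + n₁) i) + c) / q := by
      intro x q c
      push_cast
      simp only [neg_add, add_div, Finset.sum_div, ← Finset.sum_neg_distrib]
      exact congrArg₂ (· + ·) (Finset.sum_congr rfl fun i _ => by ring) (by ring)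
    simp only [hrowC]
    split_ifs with h1 h2
    · have h1' : (0 : ℝ) < (M j).1 (Fin.last b) := by exact_mod_cast h1
      simp only [hPV, Sum.elim_inr, Sum.elim_inl, hq, div_lt_iff₀ h1']
      constructor <;> intro h <;> linarith
    · have h2' : ((M j).1 (Fin.last b) : ℝ) < 0 := by exact_mod_cast h2
      simp only [hPV, Sum.elim_inr, Sum.elim_inl, hq, lt_div_iff_of_neg h2']
      constructor <;> intro h <;> linarith
    · have h0 : (M j).1 (Fin.last b) = 0 := le_antisymm (not_lt.1 h1) (not_lt.1 h2)
      simp [hPV, h0]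
  have hbv : ∀ w u,
      (∀ c, u = Sum.inr c → c.1 (Fin.last b) = 0 ∨ c = (Pi.single (Fin.last b) 1, 0)) →
      PV (bnd u) w = Sum.elim (fun j => w (Fin.natAdd b (Fin.castAdd n₁ (Fin.succ j))))
        (fun c => ∑ i, (c.1 (Fin.castSucc i) : ℝ) * w (Fin.castAdd (k + 1 + n₁) i) +
          (c.1 (Fin.last b) : ℝ) * w (Fin.natAdd b y0) + (c.2 : ℝ)) u := by
    intro w u hu
    rcases u with j | c
    · simp [hbnd, hPV]
    · rcases hu c rfl with h0 | h1
      · have hne : c ≠ (Pi.single (Fin.last b) 1, 0) := fun h => by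
          rw [h] at h0; simp at h0
        simp [hbnd, hPV, hne, h0]
      · subst h1
        simp [hbnd, hPV]
  have hPLv : ∀ w, PV PL w = if β then
      ∑ i, (ℓ₁.1 i : ℝ) * w (Fin.castAdd (k + 1 + n₁) i) + (ℓ₁.2 : ℝ)
      else w (Fin.natAdd b y0) := fun w => by cases β <;> simp [hPL, hPV]
  have hPHv : ∀ w, PV PH w = if β then w (Fin.natAdd b y0)
      else ∑ i, (ℓ₁.1 i : ℝ) * w (Fin.castAdd (k + 1 + n₁) i) + (ℓ₁.2 : ℝ) := fun w => by
    cases β <;> simp [hPH, hPV]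
  -- membership in the transported domain
  have hmem : ∀ w : Fin (b + (k + 1 + n₁)) → ℝ, w ∈ (hc ▸ U).domain ↔
      ((fun i => w (Fin.cast hc (Fin.castAdd n₁ i))) ∈ s.domain ∧
        PV PL w < PV PH w ∧ ∀ i, PV PL w < w (Fin.natAdd b (Fin.natAdd (k + 1) i)) ∧
          w (Fin.natAdd b (Fin.natAdd (k + 1) i)) < PV PH w) := by
    intro w
    obtain ⟨hA, hB⟩ := hAB β (fun i => w (Fin.cast hc (Fin.castAdd n₁ i)))
    rw [cast_domain, mem_setOf_eq, hUd]
    simp only [mem_setOf_eq, mem_inter_iff, hA, hB, hPLv, hPHv, cx, cy, cu, and_assoc]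
  have hG2 : ∀ w : Fin (b + (k + 1 + n₁)) → ℝ,
      (fun i => w (Fin.cast hc (Fin.castAdd n₁ i))) ∈ s.domain ↔
      (∀ j, 0 < ∑ i, ((M j).1 (Fin.castSucc i) : ℝ) * w (Fin.castAdd (k + 1 + n₁) i) +
        ((M j).1 (Fin.last b) : ℝ) * w (Fin.natAdd b y0) + ((M j).2 : ℝ)) ∧
      ∀ i, Sum.elim (fun j => w (Fin.natAdd b (Fin.castAdd n₁ (Fin.succ j))))
        (fun c => ∑ i, (c.1 (Fin.castSucc i) : ℝ) * w (Fin.castAdd (k + 1 + n₁) i) +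
          (c.1 (Fin.last b) : ℝ) * w (Fin.natAdd b y0) + (c.2 : ℝ)) (lo i) <
        w (Fin.natAdd b (Fin.castAdd n₁ i.succ)) ∧ w (Fin.natAdd b (Fin.castAdd n₁ i.succ)) <
        Sum.elim (fun j => w (Fin.natAdd b (Fin.castAdd n₁ (Fin.succ j))))
        (fun c => ∑ i, (c.1 (Fin.castSucc i) : ℝ) * w (Fin.castAdd (k + 1 + n₁) i) +
          (c.1 (Fin.last b) : ℝ) * w (Fin.natAdd b y0) + (c.2 : ℝ)) (hi i) := by
    intro w
    rw [hdom]
    simp only [mem_setOf_eq, Fin.sum_univ_castSucc, cx, cy, ct]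
  have hco : ∀ w : Fin (b + (k + 1 + n₁)) → ℝ,
      (fun i => w (Fin.cast hc (Fin.castAdd n₁ i))) ∈ s.domain →
      ∀ i, |w (Fin.cast hc (Fin.castAdd n₁ i))| ≤ R₀ := fun w hw i => by
    have h := norm_le_pi_norm (fun i => w (Fin.cast hc (Fin.castAdd n₁ i))) i
    rw [Real.norm_eq_abs] at h
    exact h.trans (hR₀ _ hw)
  have hy : ∀ w : Fin (b + (k + 1 + n₁)) → ℝ,
      (fun i => w (Fin.cast hc (Fin.castAdd n₁ i))) ∈ s.domain →
      -(R : ℝ) < w (Fin.natAdd b y0) ∧ w (Fin.natAdd b y0) < R := by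
    intro w hw
    have h2 := hco w hw (Fin.castAdd k (Fin.last b))
    rw [cy] at h2
    have h3 : R₀ < R := by
      rw [hR]; push_cast; exact (Nat.le_ceil R₀).trans_lt (lt_add_one _)
    rw [abs_le] at h2
    constructor <;> linarith
  refine (integrateOutLow_orderCells b (k + 1 + n₁) m (hc ▸ U) Cs L e
    (MvPolynomial.C ((if β then 1 else -1) ^ n₁) * p)
    (Fin.append (Fin.cons (if n₂ = 0 then none else some ℓ₂)
      (fun i => (a i).map fun c => (fun i => c.1 (Fin.castSucc i), c.2))) (fun _ => none))
    ?_ ?_ ?_ ?_).imp fun c hc' => ⟨hc'.1, by rw [of_cast] at hc'; exact hc'.2⟩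
  · -- bounded
    refine isBounded_of_forall_abs_le (max R₀ (∑ i, |(ℓ₁.1 i : ℝ)| * R₀ + |(ℓ₁.2 : ℝ)|))
      fun w hw j => ?_
    obtain ⟨hD, -, hu⟩ := (hmem w).1 hw
    have hx : ∀ i, |w (Fin.castAdd (k + 1 + n₁) i)| ≤ R₀ := fun i => by
      have h := hco w hD (Fin.castAdd k (Fin.castSucc i)); rwa [cx] at h
    have hyb : |w (Fin.natAdd b y0)| ≤ R₀ := by
      have h := hco w hD (Fin.castAdd k (Fin.last b)); rwa [cy] at h
    have hl : |∑ i, (ℓ₁.1 i : ℝ) * w (Fin.castAdd (k + 1 + n₁) i) + (ℓ₁.2 : ℝ)| ≤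
        ∑ i, |(ℓ₁.1 i : ℝ)| * R₀ + |(ℓ₁.2 : ℝ)| := by
      refine (abs_add_le _ _).trans (add_le_add ((Finset.abs_sum_le_sum_abs _ _).trans
        (Finset.sum_le_sum fun i _ => ?_)) le_rfl)
      rw [abs_mul]
      exact mul_le_mul_of_nonneg_left (hx i) (abs_nonneg _)
    have hav : |PV PL w| ≤ max R₀ (∑ i, |(ℓ₁.1 i : ℝ)| * R₀ + |(ℓ₁.2 : ℝ)|) ∧
        |PV PH w| ≤ max R₀ (∑ i, |(ℓ₁.1 i : ℝ)| * R₀ + |(ℓ₁.2 : ℝ)|) := by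
      rw [hPLv, hPHv]
      cases β
      · exact ⟨hyb.trans (le_max_left _ _), hl.trans (le_max_right _ _)⟩
      · exact ⟨hl.trans (le_max_right _ _), hyb.trans (le_max_left _ _)⟩
    obtain ⟨j', rfl⟩ : ∃ j', j = Fin.cast hc j' := ⟨Fin.cast hc.symm j, by simp⟩
    induction j' using Fin.addCases with
    | left i => exact (hco w hD i).trans (le_max_left _ _)
    | right i =>
      rw [cu, abs_le]
      have h1 := (hu i).1
      have h2 := (hu i).2
      simp only [abs_le] at hav
      constructor <;> linarith [hav.1.1, hav.2.2]
  · -- every fibre is bounded below and above by a constraint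
    intro v
    simp only [hCs, Finset.mem_union, Finset.mem_image, Finset.mem_univ, true_and,
      Finset.mem_insert, Finset.mem_singleton]
    induction v using Fin.addCases with
    | left v =>
      induction v using Fin.cases with
      | zero =>
        exact ⟨⟨(Sum.inr (0, -(R : ℚ)), Sum.inl y0), Or.inr (Or.inr (Or.inl rfl)), rfl⟩,
          ⟨(Sum.inl y0, Sum.inr (0, (R : ℚ))), Or.inr (Or.inr (Or.inr rfl)), rfl⟩⟩
      | succ i =>
        exact ⟨⟨(bnd (lo i), Sum.inl (Fin.castAdd n₁ i.succ)),
            Or.inl (Or.inl (Or.inl (Or.inl (Or.inr ⟨i, rfl⟩)))), rfl⟩,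
          ⟨(Sum.inl (Fin.castAdd n₁ i.succ), bnd (hi i)),
            Or.inl (Or.inl (Or.inl (Or.inr ⟨i, rfl⟩))), rfl⟩⟩
    | right i =>
      exact ⟨⟨(PL, Sum.inl (Fin.natAdd (k + 1) i)), Or.inl (Or.inl (Or.inr ⟨i, rfl⟩)), rfl⟩,
        ⟨(Sum.inl (Fin.natAdd (k + 1) i), PH), Or.inl (Or.inr ⟨i, rfl⟩), rfl⟩⟩
  · -- the domain
    ext w
    have hlo : ∀ i, PV (bnd (lo i)) w = _ := fun i => hbv w (lo i) fun c hc => hlohi i c (Or.inl hc)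
    have hhi : ∀ i, PV (bnd (hi i)) w = _ := fun i => hbv w (hi i) fun c hc => hlohi i c (Or.inr hc)
    rw [hmem, hG2]
    show _ ↔ ∀ q ∈ Cs, PV q.1 w < PV q.2 w
    simp only [hCs, Finset.forall_mem_union, Finset.forall_mem_image, Finset.mem_univ,
      true_imp_iff, Finset.forall_mem_insert, Finset.mem_singleton, forall_eq, hrow, hlo, hhi,
      forall_and]
    have hR1 : PV (Sum.inr (0, -(R : ℚ))) w = -(R : ℝ) := by simp [hPV]
    have hR2 : PV (Sum.inr (0, (R : ℚ))) w = (R : ℝ) := by simp [hPV]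
    have hv : ∀ v, PV (Sum.inl v) w = w (Fin.natAdd b v) := fun v => by simp [hPV]
    simp only [hR1, hR2, hv]
    constructor
    · intro h
      have hyy := hy w ((hG2 w).2 ⟨h.1.1, fun i => ⟨h.1.2.1 i, h.1.2.2 i⟩⟩)
      tauto
    · intro h
      tauto
  · -- the integrand
    intro w hw
    have hD := ((hmem w).1 hw).1
    rw [cast_integrand, hUi]
    have hlet : ∀ i, (a i).elim (1 : ℝ) (fun c => 1 / (w (Fin.cast hc (Fin.castAdd n₁
        (Fin.natAdd (b + 1) i))) - (∑ i', (c.1 i' : ℝ) * w (Fin.cast hc (Fin.castAdd n₁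
        (Fin.castAdd k i'))) + c.2))) =
        ((a i).map fun c => ((fun i => c.1 (Fin.castSucc i), c.2) : (Fin b → ℚ) × ℚ)).elim 1
        (fun c => 1 / (w (Fin.natAdd b (Fin.castAdd n₁ i.succ)) -
          (∑ i', (c.1 i' : ℝ) * w (Fin.castAdd (k + 1 + n₁) i') + (c.2 : ℝ)))) := by
      intro i
      rcases h : a i with _ | c
      · rfl
      · simp only [Option.elim, Option.map_some]
        rw [Fin.sum_univ_castSucc, ha i c h, ct]
        simp [cx, cy]
    have hyl : (if n₂ = 0 then none else some ℓ₂ : Option ((Fin b → ℚ) × ℚ)).elim (1 : ℝ)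
        (fun c => 1 / (w (Fin.natAdd b y0) -
          (∑ i', (c.1 i' : ℝ) * w (Fin.castAdd (k + 1 + n₁) i') + (c.2 : ℝ)))) =
        1 / (w (Fin.natAdd b y0) -
          (∑ i', (ℓ₂.1 i' : ℝ) * w (Fin.castAdd (k + 1 + n₁) i') + (ℓ₂.2 : ℝ))) ^ n₂ := by
      rcases Nat.le_one_iff_eq_zero_or_eq_one.1 hn₂ with h | h <;> simp [h]
    simp only [hlet, cx, cy, Fin.prod_univ_add, Fin.prod_univ_succ, Fin.append_left,
      Fin.append_right, Fin.cons_zero, Fin.cons_succ, Option.elim_none, Finset.prod_const_one,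
      map_mul, MvPolynomial.aeval_C, eq_ratCast, Rat.cast_pow]
    rw [← hy0, hyl]
    split_ifs <;> simp only [Rat.cast_one, Rat.cast_neg] <;> ring

end IntegrateOutLow

/-- **stub_integrateOutLow** (`G₂lo b → closure (J b)`, line `janus-bands`). Cut the base cell
at `y = ℓ₁(x')`, unfold the polynomial factor `(y − ℓ₁)^{n₁}` of each branch into `n₁`
letter-free fibre coordinates by reverse Newton–Leibniz moves, transport to dimension
`b + (k + 1 + n₁)` re-reading `y` as the first fibre (letter `ℓ₂` if `n₂ = 1`), and dissect the
resulting order-constrained Janus representation by total-order refinement into Janus band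
representations over the base `x'`. -/
theorem stub_integrateOutLow (J : ℕ → Set KZ.FormalRep) (G₂ : ℕ → Set KZ.FormalRep) (hJ : ∀ b, J b = {w : KZ.FormalRep | ∃ (k m m' : ℕ) (s : KZ.IntegralRep (b + k)) (M : Fin m' → (Fin b → ℚ) × ℚ) (L : Fin m → (Fin b → ℚ) × ℚ) (e : Fin m → ℕ) (p : MvPolynomial (Fin b) ℚ) (a : Fin k → Option ((Fin b → ℚ) × ℚ)) (lo hi : Fin k → Fin k ⊕ ((Fin b → ℚ) × ℚ)), Bornology.IsBounded s.domain ∧ s.domain = {z | (∀ j, 0 < ∑ i, ((M j).1 i : ℝ) * z (Fin.castAdd k i) + ((M j).2 : ℝ)) ∧ ∀ i, Sum.elim (fun j => z (Fin.natAdd b j)) (fun c => ∑ i', (c.1 i' : ℝ) * z (Fin.castAdd k i') + (c.2 : ℝ)) (lo i) < z (Fin.natAdd b i) ∧ z (Fin.natAdd b i) < Sum.elim (fun j => z (Fin.natAdd b j)) (fun c => ∑ i', (c.1 i' : ℝ) * z (Fin.castAdd k i') + (c.2 : ℝ)) (hi i)} ∧ EqOn s.integrand (fun z => MvPolynomial.aeval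 (fun i => z (Fin.castAdd k i)) p / (∏ j, (∑ i, ((L j).1 i : ℝ) * z (Fin.castAdd k i) + ((L j).2 : ℝ)) ^ e j) * ∏ i, (a i).elim 1 (fun c => 1 / (z (Fin.natAdd b i) - (∑ i', (c.1 i' : ℝ) * z (Fin.castAdd k i') + (c.2 : ℝ))))) s.domain ∧ w = KZ.of s}) (hG₂ : ∀ b, G₂ b = {w : KZ.FormalRep | ∃ (k m m' n₁ n₂ : ℕ) (s : KZ.IntegralRep (b + 1 + k)) (M : Fin m' → (Fin (b + 1) → ℚ) × ℚ) (L : Fin m → (Fin b → ℚ) × ℚ) (e : Fin m → ℕ) (p : MvPolynomial (Fin b) ℚ) (ℓ₁ ℓ₂ : (Fin b → ℚ) × ℚ) (a : Fin k → Option ((Fin (b + 1) → ℚ) × ℚ)) (lo hi : Fin k → Fin k ⊕ ((Fin (b + 1) → ℚ) × ℚ)), (n₁ = 0 ∨ n₂ = 0) ∧ n₂ ≤ 1 ∧ (∀ i c, a i = some c → c.1 (Fin.last b) = 0) ∧ (∀ i c, (lo i = Sum.inr c ∨ hi i = Sum.inr c) → (c.1 (Fin.last b) = 0 ∨ c = (Pi.single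 (Fin.last b) 1, 0))) ∧ Bornology.IsBounded s.domain ∧ s.domain = {z | (∀ j, 0 < ∑ i, ((M j).1 i : ℝ) * z (Fin.castAdd k i) + ((M j).2 : ℝ)) ∧ ∀ i, Sum.elim (fun j => z (Fin.natAdd (b + 1) j)) (fun c => ∑ i', (c.1 i' : ℝ) * z (Fin.castAdd k i') + (c.2 : ℝ)) (lo i) < z (Fin.natAdd (b + 1) i) ∧ z (Fin.natAdd (b + 1) i) < Sum.elim (fun j => z (Fin.natAdd (b + 1) j)) (fun c => ∑ i', (c.1 i' : ℝ) * z (Fin.castAdd k i') + (c.2 : ℝ)) (hi i)} ∧ EqOn s.integrand (fun z => MvPolynomial.aeval (fun i => z (Fin.castAdd k (Fin.castSucc i))) p / (∏ j, (∑ i, ((L j).1 i : ℝ) * z (Fin.castAdd k (Fin.castSucc i)) + ((L j).2 : ℝ)) ^ e j) * ((z (Fin.castAdd k (Fin.last b)) - (∑ i, (ℓ₁.1 i : ℝ) * z (Fin.castAdd k (Fin.castSucc i)) + (ℓ₁.2 : ℝ))) ^ n₁ / (z (Fin.castAdd k (Fin.last b)) - (∑ i, (ℓ₂.1 i : ℝ)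 * z (Fin.castAdd k (Fin.castSucc i)) + (ℓ₂.2 : ℝ))) ^ n₂) * ∏ i, (a i).elim 1 (fun c => 1 / (z (Fin.natAdd (b + 1) i) - (∑ i', (c.1 i' : ℝ) * z (Fin.castAdd k i') + (c.2 : ℝ))))) s.domain ∧ w = KZ.of s}) (b : ℕ) : ∀ x ∈ G₂ b, ∃ c ∈ AddSubgroup.closure (J b), x - c ∈ KZ.relations := by
  intro x hx
  rw [hJ]
  rw [hG₂] at hx
  obtain ⟨k, m, m', n₁, n₂, s, M, L, e, p, ℓ₁, ℓ₂, a, lo, hi, -, hn₂, ha, hlohi, hbd, hdom, hint,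
    rfl⟩ := hx
  set A : Bool → MvPolynomial (Fin (b + 1 + k)) ℚ := fun β => if β then
      rename (fun i => Fin.castAdd k (Fin.castSucc i))
        (∑ i, MvPolynomial.C (ℓ₁.1 i) * X i + MvPolynomial.C ℓ₁.2)
    else X (Fin.castAdd k (Fin.last b)) with hA
  set B : Bool → MvPolynomial (Fin (b + 1 + k)) ℚ := fun β =>
    if β then X (Fin.castAdd k (Fin.last b)) else rename (fun i => Fin.castAdd k (Fin.castSucc i))
      (∑ i, MvPolynomial.C (ℓ₁.1 i) * X i + MvPolynomial.C ℓ₁.2) with hB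
  have hAB : ∀ β z, (aeval z (A β) = if β then ∑ i, (ℓ₁.1 i : ℝ) *
      z (Fin.castAdd k (Fin.castSucc i)) + (ℓ₁.2 : ℝ) else z (Fin.castAdd k (Fin.last b))) ∧
      (aeval z (B β) = if β then z (Fin.castAdd k (Fin.last b)) else
      ∑ i, (ℓ₁.1 i : ℝ) * z (Fin.castAdd k (Fin.castSucc i)) + (ℓ₁.2 : ℝ)) := by
    intro β z
    cases β <;> simp [hA, hB]
  have hU := fun β => IntegrateOutLow.exists_unfolded s ℓ₁ A B hAB L e p ℓ₂ a
    (n₁ := n₁) (n₂ := n₂) hint β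
  choose U hUd hUi hUr using hU
  have hJ' := fun β => IntegrateOutLow.exists_J_of_unfolded s ℓ₁ A B hAB L e p ℓ₂ a M lo hi hn₂
    ha hlohi hbd hdom β (U β) (hUd β) (hUi β)
  choose c hc hcr using hJ'
  refine ⟨∑ β, c β, sum_mem fun β _ => hc β, ?_⟩
  have h1 := IntegrateOutLow.of_sub_sum_branch s ℓ₁ A B hAB
  have h2 := AddSubgroup.sum_mem KZ.relations fun β (_ : β ∈ (Finset.univ : Finset Bool)) => hUr β
  have h3 := AddSubgroup.sum_mem KZ.relations fun β (_ : β ∈ (Finset.univ : Finset Bool)) => hcr β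
  simp only [Finset.sum_sub_distrib] at h2 h3
  convert KZ.relations.add_mem (KZ.relations.add_mem h1 h2) h3 using 1
  abel

end Summit.KontsevichZagierPeriods.ArrangementNormalForm.JanusBands
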